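import Summits.CriticalPhenomena.PercolationContinuityZ3.Theorems.PercNearOneGluingNoHeavyQuantFarTreeRootReductionDIB
import Summits.CriticalPhenomena.PercolationContinuityZ3.Theorems.PercNearOneGluingNoHeavyQuantTwoBigJCert
import HarnessLib

/-!
# QUANT lane R8 — the DIB hypothesis DISCHARGED wherever it is taken: the conditional root row `rtail_ge_of_decCert` and
# `farTree_of_decCert` at EVERY floor `x < 1` (resp. every `t > 0`), by `dibStar_holds_J`

builds on p205010 (kernel theorem, internal audit signed; external expert review pending)

Support file (`--supports stmt-CriticalPhenomena-4575`), QUANT lane typer seat prim-quant-stmt (gen 23); the bookkeeping asked for in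
README V244 (i).  Theorems only; no sorries, standard axioms; no new conjectures.

T-DIB is a kernel theorem: `Quant.IndepBlob.dibStar_holds_J : ∀ x < 1, DIBStar x` (`…QuantTwoBigJCert`, p1 g13, p292639).  The two places
of the R8 architecture where the discounted-independent-blob row is TAKEN AS A HYPOTHESIS `hD : DIBWith x ψ` are
`Quant.RootDec.rtail_ge_of_decCert` (`…QuantDIBStar`: DEC-certificate ∧ DIB ⟹ FAR at the root, law coordinates) and
`Quant.RootDecGate.farTree_of_decCert` (`…QuantFarTreeRootReductionDIB`: the same in gate coordinates, concluding `Quant.FarTreeRow`'s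
inequality instance-wise).  Until now they were unconditional only at floors `x ≤ 1/2` (`rtail_ge_of_decCert_of_le_half`,
`farTree_of_decCert_of_le_half`).  This file supplies `hD` at every floor:

* `Quant.RootDec.rtail_ge_of_decCert_of_lt_one` — R3 with the DIB\* credit `κ_x(g) = (g − x²)/(1 − x)`, every floor `x < 1`, NO DIB hypothesis.
* `Quant.RootDec.rtail_ge_of_decCert_psi_of_lt_one` — the same with census-2's ψ-credit `ψ_x(g) = g − (x − g)/(1 − x)` (`DIBPsi`, weaker credit,
  sometimes the form in which a certificate was computed).
* `Quant.RootDecGate.farTree_of_decCert_of_pos` — gate coordinates: a DEC-certificate (β/α/γ with credit `κ_{1−t}`) for every genuine term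
  ⟹ `P(N ≤ j) ≤ t`, for EVERY `t > 0`.
* `Quant.RootDecGate.farTree_of_decCert_psi_of_pos` — the same with the ψ-credit.

So the root row of the tree architecture is now conditional on the DEC-CERTIFICATE SIDE ONLY (T-DEC: which decompositions / term
certificates exist — `LawDec.TreeBuiltDEC ⟸ LawDec.SDECConvClosed`, of which `LawDec.SliceClosed` is the one-blob case; all OPEN);
`Quant.FarTreeRow` itself remains OPEN.

STATUS OF THE TYPED `@[conjecture]` ROWS OF THE T-DIB PROGRAMME after p292639 (docstring level, for planners; nothing below is used in a proof):
PROVED — `DIBStar x` and `DIBPsi x` for all `x < 1` (`dibStar_holds_J`; `dibPsi_holds`, `…QuantDIBStarHolds`); `DIBStarCorner x`, `x < 1`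
(`dibStarCorner_holds`); `StepLemmaFS`, `StepLemmaFSBig`, `StepLemmaFSCore`, `StepLemmaFSMid`, `StepLemmaFSLumpy`, `StepLemmaFSLumpyPC`,
`StepLemmaFSTwoBigs`, `StepLemmaFSResidual` (`…QuantDIBStarHolds`, each `↔`/`⟸ ∀ x<1, DIBStar x`); `OneBigCert` (`oneBigCert_holds`,
`…QuantOneBigCert`); `TwoBigCertJ` (`twoBigCertJ_holds'`) and `TwoBigCert` (`twoBigCert_holds_of_J`) (`…QuantTwoBigJCert`).
MOOT (certificate-EXISTENCE statements asserting that one particular MENU certifies every hard-corner instance; each was typed only as a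
sufficient condition for T-DIB — `dibStar_of_coCert`, `FSE`/`StepFSE*`/`StepLemmaFSMenu` ⟹ step lemma — and none is implied by T-DIB):
`COCert`, `FSE`, `FSEResidual`, `StepFSE`, `StepFSEMax`, `StepFSECells`, `StepLemmaFSMenu`.  They stay OPEN as real inequalities and are no
longer on any path of the lane.

[this work]; the gluing rows served [cite: KozmaNitzan2024, Conjecture 3 (p. 15)]; product weights [cite: Grimmett1999, §1.3 p. 10].
-/

noncomputable section

namespace Summit.CriticalPhenomena.PercolationContinuityZ3.Theorems

namespace Quant

/-! ### 1. Law coordinates: R3 at every floor `x < 1` -/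

namespace RootDec

open Finset

variable {κ : Type} [Fintype κ] [DecidableEq κ]

/-- configurations of structure counts bounded by `M` (as in `…QuantRootReduction`) -/
local notation3 "cfg[" M "]" => Fintype.piFinset (fun k : κ => Finset.range ((M : κ → ℕ) k + 1))

/-- the ROOT tail (as in `…QuantRootReduction`) -/
local notation3 "RTAIL[" M ", " μ ", " j "]" =>
  ∑ c ∈ cfg[M], (∏ k, (μ : κ → ℕ → ℝ) k ((c : κ → ℕ) k)) * (if (j : ℕ) + 1 ≤ ∑ k, (c : κ → ℕ) k then (1 : ℝ) else 0)

/-- the two-point law `{lo, hi; g}` (as in `…QuantRootReduction`) -/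
local notation3 "TP[" lo ", " hi ", " g ", " h "]" =>
  (g : ℝ) * (if (h : ℕ) = (hi : ℕ) then (1 : ℝ) else 0) + (1 - (g : ℝ)) * (if (h : ℕ) = (lo : ℕ) then (1 : ℝ) else 0)

/-- **R3 at every floor `x < 1`, unconditional (DIB\* credit).**  `Quant.RootDec.rtail_ge_of_decCert` with the DIB hypothesis
discharged by `IndepBlob.dibStar_holds_J`: structure laws decomposed into two-point components (genuine gates in `[0,1]`), every
genuine term certified by β (sure mass `≥ j+1`) / α (a heavy giant) / γ (effective discounted credit `> 2(j − s)` with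
`ψ = κ_x`, `κ_x(g) = (g − x²)/(1 − x)`) ⟹ `x ≤ RTAIL[M, μ, j]`. [this work] -/
theorem rtail_ge_of_decCert_of_lt_one {ρ : Type*} [Fintype ρ] [DecidableEq ρ] {x : ℝ} (hx1 : x < 1)
    (M : κ → ℕ) (μ : κ → ℕ → ℝ) (lam : κ → ρ → ℝ) (lo hi : κ → ρ → ℕ) (g : κ → ρ → ℝ) (j : ℕ)
    (hlam0 : ∀ k r, 0 ≤ lam k r) (hlam1 : ∀ k, ∑ r, lam k r = 1)
    (hμ : ∀ k h, μ k h = ∑ r, lam k r * TP[lo k r, hi k r, g k r, h])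
    (hlohi : ∀ k r, lo k r ≤ hi k r) (hhi : ∀ k r, hi k r ≤ M k)
    (hg : ∀ k r, 0 < lam k r → 0 ≤ g k r ∧ g k r ≤ 1)
    (hcert : ∀ σ : κ → ρ, (∀ k, 0 < lam k (σ k)) →
      (j + 1 ≤ ∑ k, lo k (σ k)) ∨
      (∃ k, x ≤ g k (σ k) ∧ j + 1 ≤ (∑ k', lo k' (σ k')) + (hi k (σ k) - lo k (σ k))) ∨
      ((2 * j : ℝ) < 2 * ((∑ k, lo k (σ k) : ℕ) : ℝ) + ∑ k, (if x ≤ g k (σ k)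
        then ((hi k (σ k) - lo k (σ k) : ℕ) : ℝ) * g k (σ k)
        else ((min (hi k (σ k) - lo k (σ k)) (j - ∑ k', lo k' (σ k')) : ℕ) : ℝ) *
          max ((g k (σ k) - x ^ 2) / (1 - x)) 0))) :
    x ≤ RTAIL[M, μ, j] :=
  rtail_ge_of_decCert (IndepBlob.dibStar_holds_J x hx1).dibWith M μ lam lo hi g j hx1.le hlam0 hlam1 hμ hlohi hhi hg hcert

/-- **R3 at every floor `x < 1`, unconditional (ψ-credit).**  The same with census-2's weaker credit
`ψ_x(g) = g − (x − g)/(1 − x)` (`IndepBlob.DIBPsi`, discharged by `dibPsi_of_dibStar` + `dibStar_holds_J`). [this work] -/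
theorem rtail_ge_of_decCert_psi_of_lt_one {ρ : Type*} [Fintype ρ] [DecidableEq ρ] {x : ℝ} (hx1 : x < 1)
    (M : κ → ℕ) (μ : κ → ℕ → ℝ) (lam : κ → ρ → ℝ) (lo hi : κ → ρ → ℕ) (g : κ → ρ → ℝ) (j : ℕ)
    (hlam0 : ∀ k r, 0 ≤ lam k r) (hlam1 : ∀ k, ∑ r, lam k r = 1)
    (hμ : ∀ k h, μ k h = ∑ r, lam k r * TP[lo k r, hi k r, g k r, h])
    (hlohi : ∀ k r, lo k r ≤ hi k r) (hhi : ∀ k r, hi k r ≤ M k)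
    (hg : ∀ k r, 0 < lam k r → 0 ≤ g k r ∧ g k r ≤ 1)
    (hcert : ∀ σ : κ → ρ, (∀ k, 0 < lam k (σ k)) →
      (j + 1 ≤ ∑ k, lo k (σ k)) ∨
      (∃ k, x ≤ g k (σ k) ∧ j + 1 ≤ (∑ k', lo k' (σ k')) + (hi k (σ k) - lo k (σ k))) ∨
      ((2 * j : ℝ) < 2 * ((∑ k, lo k (σ k) : ℕ) : ℝ) + ∑ k, (if x ≤ g k (σ k)
        then ((hi k (σ k) - lo k (σ k) : ℕ) : ℝ) * g k (σ k)
        else ((min (hi k (σ k) - lo k (σ k)) (j - ∑ k', lo k' (σ k')) : ℕ) : ℝ) *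
          max (g k (σ k) - (x - g k (σ k)) / (1 - x)) 0))) :
    x ≤ RTAIL[M, μ, j] :=
  rtail_ge_of_decCert (IndepBlob.dibPsi_of_dibStar hx1 (IndepBlob.dibStar_holds_J x hx1)).dibWith M μ lam lo hi g j hx1.le
    hlam0 hlam1 hμ hlohi hhi hg hcert

end RootDec

/-! ### 2. Gate coordinates: `Quant.FarTreeRow`'s inequality instance-wise from a DEC-certificate, every `t > 0` -/

namespace RootDecGate

open Finset MeasureTheory
open Literature.Probability.LatticeModels
open Literature.Probability.Percolation
open scoped Classical

variable {E : Type*} [Fintype E] {κ : Type} [Fintype κ] [DecidableEq κ]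

/-- the two-point law `{lo, hi; g}` (as in `…QuantRootReduction`) -/
local notation3 "TP[" lo ", " hi ", " g ", " h "]" =>
  (g : ℝ) * (if (h : ℕ) = (hi : ℕ) then (1 : ℝ) else 0) + (1 - (g : ℝ)) * (if (h : ℕ) = (lo : ℕ) then (1 : ℝ) else 0)

/-- the relays of structure `k` reached in `ω` (as in `…QuantFarTreeRootReduction`) -/
local notation3 "Nk[" A ", " P ", " comp ", " k ", " ω "]" =>
  (((A : Finset E).filter fun a => (comp : E → κ) a = k).filter fun a => (((P : E → Finset E) a : Finset E) : Set E) ⊆ (ω : Set E)).card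

/-- **The conditional root row made unconditional at EVERY `t > 0`** (`IndepBlob.dibStar_holds_J` at floor `1 − t < 1`): in the
setting of `…QuantFarTreeRootReduction` (independent gates `q`, relays `A`, ancestor sets `P`, labelling `comp` constant along
ancestry), structure laws decomposed into two-point components with genuine gates in `[0,1]`, and a DEC-certificate — β (sure mass
`≥ j+1`) / α (a heavy giant) / γ (effective discounted credit `> 2(j − s)` with the DIB\* credit `κ_{1−t}`) — for every genuine term
⟹ `P(N ≤ j) ≤ t`.  Which decompositions/certificates EXIST (T-DEC) is not asserted. [this work] -/
theorem farTree_of_decCert_of_pos {ρ : Type*} [Fintype ρ] [DecidableEq ρ] (q : E → unitInterval) (A : Finset E)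
    (P : E → Finset E) (comp : E → κ) (hP : ∀ a ∈ A, ∀ y ∈ P a, comp y = comp a) (j : ℕ) (t : ℝ) (ht : 0 < t)
    (lam : κ → ρ → ℝ) (lo hi : κ → ρ → ℕ) (g : κ → ρ → ℝ)
    (hlam0 : ∀ k r, 0 ≤ lam k r) (hlam1 : ∀ k, ∑ r, lam k r = 1)
    (hμ : ∀ k h, (prodBernoulli q).real {ω : Set E | Nk[A, P, comp, k, ω] = h} =
      ∑ r, lam k r * TP[lo k r, hi k r, g k r, h])
    (hlohi : ∀ k r, lo k r ≤ hi k r) (hhi : ∀ k r, hi k r ≤ (A.filter fun a => comp a = k).card)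
    (hg : ∀ k r, 0 < lam k r → 0 ≤ g k r ∧ g k r ≤ 1)
    (hcert : ∀ σ : κ → ρ, (∀ k, 0 < lam k (σ k)) →
      (j + 1 ≤ ∑ k, lo k (σ k)) ∨
      (∃ k, 1 - t ≤ g k (σ k) ∧ j + 1 ≤ (∑ k', lo k' (σ k')) + (hi k (σ k) - lo k (σ k))) ∨
      ((2 * j : ℝ) < 2 * ((∑ k, lo k (σ k) : ℕ) : ℝ) + ∑ k, (if 1 - t ≤ g k (σ k)
        then ((hi k (σ k) - lo k (σ k) : ℕ) : ℝ) * g k (σ k)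
        else ((min (hi k (σ k) - lo k (σ k)) (j - ∑ k', lo k' (σ k')) : ℕ) : ℝ) *
          max ((g k (σ k) - (1 - t) ^ 2) / (1 - (1 - t))) 0))) :
    (prodBernoulli q).real {ω : Set E | (A.filter fun a => ((P a : Finset E) : Set E) ⊆ ω).card ≤ j} ≤ t :=
  farTree_of_decCert q A P comp hP j t ht.le (IndepBlob.dibStar_holds_J (1 - t) (by linarith)).dibWith lam lo hi g hlam0
    hlam1 hμ hlohi hhi hg hcert

/-- **The conditional root row at every `t > 0`, ψ-credit** (`ψ_{1−t}(g) = g − (1 − t − g)/t`, census-2's `DIBPsi`,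
discharged by `dibPsi_of_dibStar` + `dibStar_holds_J`). [this work] -/
theorem farTree_of_decCert_psi_of_pos {ρ : Type*} [Fintype ρ] [DecidableEq ρ] (q : E → unitInterval) (A : Finset E)
    (P : E → Finset E) (comp : E → κ) (hP : ∀ a ∈ A, ∀ y ∈ P a, comp y = comp a) (j : ℕ) (t : ℝ) (ht : 0 < t)
    (lam : κ → ρ → ℝ) (lo hi : κ → ρ → ℕ) (g : κ → ρ → ℝ)
    (hlam0 : ∀ k r, 0 ≤ lam k r) (hlam1 : ∀ k, ∑ r, lam k r = 1)
    (hμ : ∀ k h, (prodBernoulli q).real {ω : Set E | Nk[A, P, comp, k, ω] = h} =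
      ∑ r, lam k r * TP[lo k r, hi k r, g k r, h])
    (hlohi : ∀ k r, lo k r ≤ hi k r) (hhi : ∀ k r, hi k r ≤ (A.filter fun a => comp a = k).card)
    (hg : ∀ k r, 0 < lam k r → 0 ≤ g k r ∧ g k r ≤ 1)
    (hcert : ∀ σ : κ → ρ, (∀ k, 0 < lam k (σ k)) →
      (j + 1 ≤ ∑ k, lo k (σ k)) ∨
      (∃ k, 1 - t ≤ g k (σ k) ∧ j + 1 ≤ (∑ k', lo k' (σ k')) + (hi k (σ k) - lo k (σ k))) ∨
      ((2 * j : ℝ) < 2 * ((∑ k, lo k (σ k) : ℕ) : ℝ) + ∑ k, (if 1 - t ≤ g k (σ k)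
        then ((hi k (σ k) - lo k (σ k) : ℕ) : ℝ) * g k (σ k)
        else ((min (hi k (σ k) - lo k (σ k)) (j - ∑ k', lo k' (σ k')) : ℕ) : ℝ) *
          max (g k (σ k) - (1 - t - g k (σ k)) / (1 - (1 - t))) 0))) :
    (prodBernoulli q).real {ω : Set E | (A.filter fun a => ((P a : Finset E) : Set E) ⊆ ω).card ≤ j} ≤ t :=
  farTree_of_decCert q A P comp hP j t ht.le
    (IndepBlob.dibPsi_of_dibStar (by linarith) (IndepBlob.dibStar_holds_J (1 - t) (by linarith))).dibWith lam lo hi g hlam0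
    hlam1 hμ hlohi hhi hg hcert

end RootDecGate

end Quant

end Summit.CriticalPhenomena.PercolationContinuityZ3.Theorems
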